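import Summits.FinalStateConjecture.FinalStateConjecture.Theorems.PhotonSphereChannelsChannelsResolveTameDevelopmentsRKerrDevTransport
import Literature.Geometry.Lorentzian.SpacetimeLocalConvergenceChartTransport
import Literature.Geometry.Lorentzian.KerrSchildCoord
import HarnessLib

/-!
# Route PhotonSphereChannels · crux `ChannelsResolveTameDevelopmentsR` (K2R) — pushing the window deviation of
# an EXTENDABLE anchored chart through a pointed `Cᵏ_loc` limit (line `kerr-isolation-dichotomy`; supports
# stub S1 `stub_silentHullExtraction`: the deviation half of its one-sided dictionary)

Let `Dat : (𝓢ₙ, pₙ) ⇀ (𝓢, p)` be a pointed `Cᵏ_loc` subconvergence datum (`Spacetime.LocalSubconvergence`)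
with comparison maps `φₙ = Dat.embed n`, and let `Ψ : Kerr.exterior M a → 𝓢` be a chart which, on the Kerr
window `W = B_R(x₀) ∩ {r > r₊}`, is the restriction of a map `Ψ' : E4 → 𝓢` smooth on an open set
`O ⊇ closure W` (EXTENDABLE chart: across the horizon side `{r = r₊}`, the sphere `∂B_R(x₀)` and, for
`M = a = 0`, the punctured axis). Then the window `Cᵏ`-deviation of the pushed chart `φₙ ∘ Ψ` exceeds that of
`Ψ` by at most `o(1)`:

* `eventually_supCkENorm_deviationExtend_embed_comp_lt` — if
  `supCkENorm W k (Ψ^* g − g_{M,a}) < ε` then eventually `supCkENorm W k ((φₙ ∘ Ψ)^* gₙ − g_{M,a}) < ε`.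

This is the deviation half of S1's deviation dictionary (upper semicontinuity of `kerrDev` along pointed
limits); the other half — that `φₙ ∘ Ψ` is again an ADMISSIBLE anchored window chart (`IsWindowChart`:
anchor, smooth, injective, `∂_{t*}` future-directed where `r > 2M`) — holds for the first three clauses by
`embed_basepoint` / `eventually_subset_U`, while the orientation clause needs a timelike margin (recorded in
the worker report of stub S1; not treated here).

Mechanism: the Literature transport theorem
`Spacetime.LocalSubconvergence.tendsto_supCkENorm_deviationExtend_comp_sub` (Petersen 2006, Ch. 10 §3.2;
Anderson 2004, §5) gives `supCkENorm K k (dev(φₙ ∘ Ψ) − dev Ψ) → 0` on COMPACT `K` inside the background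
domain — but the closed window is NOT inside the exterior `{r > r₊}` when it touches the horizon. We apply
the theorem to the ENLARGED background `⟨O, Kerr.bilin M a, x⁰, r⟩` (a `ModelBackground` is a plain record)
and the representative `Ψ' ∘ Subtype.val`, with `K = closure W ⊆ O` compact, and identify the deviations
of the two backgrounds as GERMS at window points (the window is open: `isOpen_image_kerrWindow`); the `Cᵏ`
sup norm over `W` of the pushed deviation is then at most `dev + o(1)` by subadditivity
(`supCkENorm_add_le`, smoothness of `Kerr.bilin` on `{r > 0}`: `Kerr.contDiffAt_bilin`).
-/

noncomputable section

-- the operator-norm instance on `E4 →L[ℝ] E4 →L[ℝ] ℝ` needs one more level of pending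
-- instance problems than the default (as in `PhotonSphereChannelsKerrDevDefs.lean`)
set_option maxSynthPendingDepth 3
-- every `Summit.FinalStateConjecture.FinalStateConjecture.…` name repeats the summit = sub-problem segment (D-0017 layout)
set_option linter.dupNamespace false

open Set Filter Function TopologicalSpace Manifold Bundle
open scoped Topology Manifold ContDiff ENNReal NNReal

namespace Summit.FinalStateConjecture.FinalStateConjecture.Theorems

open Literature.Geometry.Lorentzian
open Summit.FinalStateConjecture.FinalStateConjecture.Theorems.TameHull

section Push

variable {𝓢 𝓣 : Spacetime.{0} 4}

/-- The pullback of the metric at `x` only depends on the germ of the map at `x` (subtype-source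
version of `pullbackBilin_congr_of_eventuallyEq`; adapted from `AFEndChartPullback.lean`). [cite: ONeill1983, Ch. 3, Def. 3.9] -/
theorem pullbackBilin_congr_of_eventuallyEq_exterior {M a : ℝ} {f f' : Kerr.exterior M a → 𝓣.carrier}
    {x : Kerr.exterior M a} (h : f =ᶠ[𝓝 x] f') :
    pullbackBilin (I := 𝓡 4) (I' := 𝓘(ℝ, E4)) f 𝓣.metric.val x =
      pullbackBilin (I := 𝓡 4) (I' := 𝓘(ℝ, E4)) f' 𝓣.metric.val x := by
  have hpt : f x = f' x := h.eq_of_nhds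
  have hd : mfderiv 𝓘(ℝ, E4) (𝓡 4) f x = mfderiv 𝓘(ℝ, E4) (𝓡 4) f' x := h.mfderiv_eq
  have key : ∀ (q : 𝓣.carrier) (_ : q = f' x) (L : E4 →L[ℝ] TangentSpace (𝓡 4) q)
      (_ : ∀ v, HEq (L v) (mfderiv 𝓘(ℝ, E4) (𝓡 4) f' x v)) (v w : E4),
      𝓣.metric.val q (L v) (L w) =
        𝓣.metric.val (f' x) (mfderiv 𝓘(ℝ, E4) (𝓡 4) f' x v) (mfderiv 𝓘(ℝ, E4) (𝓡 4) f' x w) := by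
    rintro q rfl L hL v w
    rw [eq_of_heq (hL v), eq_of_heq (hL w)]
  ext v w
  rw [pullbackBilin_apply, pullbackBilin_apply]
  exact key _ hpt _ (fun v ↦ heq_of_eq (by rw [hd]; rfl)) v w

/-- **The window deviation as a first bracket of the representative.** If `Ψ = Ψ' ∘ val` on the (open)
window and `F ∘ Ψ'` is differentiable on an open `V`, then at every window point `y ∈ V` the deviation
`deviationExtend (Kerr.background M a) (F ∘ Ψ)` has the germ of `y' ↦ metricInCoords (F ∘ Ψ') y' − g_{M,a}(y')`.
(`F = id`: the chart itself; `F = Dat.embed n`: the pushed chart.) [folklore] -/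
theorem deviationExtend_comp_eventuallyEq_of_eqOn {M a R : ℝ} {x₀ : Kerr.exterior M a}
    {Ψ : Kerr.exterior M a → 𝓢.carrier} {Ψ' : E4 → 𝓢.carrier} (F : 𝓢.carrier → 𝓣.carrier)
    (hΨ : ∀ x ∈ kerrWindow M a x₀ R, Ψ x = Ψ' x.1) {V : Set E4} (hV : IsOpen V)
    (hd : ∀ z ∈ V, MDifferentiableAt 𝓘(ℝ, E4) (𝓡 4) (F ∘ Ψ') z) {y : E4}
    (hy : y ∈ Subtype.val '' kerrWindow M a x₀ R) (hyV : y ∈ V) :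
    𝓣.deviationExtend (Kerr.background M a) (F ∘ Ψ) =ᶠ[𝓝 y]
      fun y' ↦ 𝓣.metricInCoords (F ∘ Ψ') y' - Kerr.bilin M a y' := by
  have hopen : IsOpen (Subtype.val '' kerrWindow M a x₀ R ∩ V) :=
    (isOpen_image_kerrWindow M a x₀ R).inter hV
  filter_upwards [hopen.mem_nhds ⟨hy, hyV⟩] with z hz
  obtain ⟨⟨x, hxW, rfl⟩, hzV⟩ := hz
  rw [Spacetime.deviationExtend_coe]
  unfold Spacetime.deviation
  -- the germ of `F ∘ Ψ` at `x` is that of `(F ∘ Ψ') ∘ val`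
  have hgerm : (F ∘ Ψ) =ᶠ[𝓝 x] ((F ∘ Ψ') ∘ (Subtype.val : Kerr.exterior M a → E4)) := by
    filter_upwards [(isOpen_kerrWindow M a x₀ R).mem_nhds hxW] with w hw
    show F (Ψ w) = F (Ψ' w.1)
    rw [hΨ w hw]
  have h1 : pullbackBilin (I := 𝓡 4) (I' := 𝓘(ℝ, E4)) (F ∘ Ψ) 𝓣.metric.val x =
      pullbackBilin (I := 𝓡 4) (I' := 𝓘(ℝ, E4)) ((F ∘ Ψ') ∘ (Subtype.val : Kerr.exterior M a → E4))
        𝓣.metric.val x :=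
    pullbackBilin_congr_of_eventuallyEq_exterior hgerm
  have h2 := 𝓣.pullbackBilin_comp_subtypeVal_eq_metricInCoords (U := Kerr.exterior M a)
    (ψ := F ∘ Ψ') x (hd _ hzV)
  change (show E4 →L[ℝ] E4 →L[ℝ] ℝ from
      pullbackBilin (I := 𝓡 4) (I' := 𝓘(ℝ, E4)) (F ∘ Ψ) 𝓣.metric.val x) -
        (Kerr.background M a).bilin x.1 = 𝓣.metricInCoords (F ∘ Ψ') x.1 - Kerr.bilin M a x.1
  rw [← h2]
  exact congrArg (fun T : E4 →L[ℝ] E4 →L[ℝ] ℝ ↦ T - Kerr.bilin M a x.1) h1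

/-- **The deviation of a representative on ANY background as a first bracket**: for a background `B'`
(e.g. the ENLARGED background `⟨O, g_{M,a}, x⁰, r⟩` of an extension set `O`), a total map `Ψ' : E4 → 𝓢`
and `F : 𝓢 → 𝓣` with `F ∘ Ψ'` differentiable on an open `V`, the deviation
`deviationExtend B' (F ∘ Ψ' ∘ val)` has at every point of `B'.domain ∩ V` the germ of
`y' ↦ metricInCoords (F ∘ Ψ') y' − B'.bilin y'`. [folklore] -/
theorem deviationExtend_repr_eventuallyEq (B' : ModelBackground) {Ψ' : E4 → 𝓢.carrier}
    (F : 𝓢.carrier → 𝓣.carrier) {V : Set E4} (hV : IsOpen V)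
    (hd : ∀ z ∈ V, MDifferentiableAt 𝓘(ℝ, E4) (𝓡 4) (F ∘ Ψ') z) {y : E4} (hyO : y ∈ B'.domain)
    (hyV : y ∈ V) :
    𝓣.deviationExtend B' (fun z : B'.domain ↦ F (Ψ' z.1)) =ᶠ[𝓝 y]
      fun y' ↦ 𝓣.metricInCoords (F ∘ Ψ') y' - B'.bilin y' := by
  filter_upwards [(B'.domain.isOpen.inter hV).mem_nhds ⟨hyO, hyV⟩] with z hz
  have hzO : z ∈ B'.domain := hz.1
  rw [show z = ((⟨z, hzO⟩ : B'.domain) : E4) from rfl, Spacetime.deviationExtend_coe]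
  unfold Spacetime.deviation
  have h2 := 𝓣.pullbackBilin_comp_subtypeVal_eq_metricInCoords (U := B'.domain) (ψ := F ∘ Ψ') ⟨z, hzO⟩
    (hd _ hz.2)
  change (show E4 →L[ℝ] E4 →L[ℝ] ℝ from
      pullbackBilin (I := 𝓡 4) (I' := 𝓘(ℝ, E4)) ((F ∘ Ψ') ∘ (Subtype.val : B'.domain → E4))
        𝓣.metric.val ⟨z, hzO⟩) - B'.bilin z = 𝓣.metricInCoords (F ∘ Ψ') z - B'.bilin z
  rw [← h2]

end Push

/-! ### The deviation half of the dictionary -/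

/-- **Pushing the window deviation of an extendable chart through a pointed limit.** Let
`Dat : (𝓢ₙ, pₙ) ⇀ (𝓢, p)` be a pointed `Cᵏ_loc` datum, `Ψ` a chart of the Kerr exterior which agrees on the
window `B_R(x₀) ∩ {r > r₊}` with a map `Ψ'` smooth on an open `O ⊇ closure (window)`. If the window
`Cᵏ`-deviation of `Ψ` is `< ε`, then eventually the window `Cᵏ`-deviation of the pushed chart
`Dat.embed n ∘ Ψ` is `< ε`: it is at most `dev(Ψ) +` the `Cᵏ` sup norm over the compact closed window of
the difference of deviations for the ENLARGED background `⟨O, g_{M,a}⟩`, which tends to `0` by the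
Literature transport theorem `LocalSubconvergence.tendsto_supCkENorm_deviationExtend_comp_sub`.
[cite: Petersen2006, Ch. 10 §3.2] -/
theorem eventually_supCkENorm_deviationExtend_embed_comp_lt : ∀ {𝓢ₙ : ℕ → Spacetime.{0} 4} {pₙ : ∀ n, (𝓢ₙ n).carrier} {𝓢 : Spacetime.{0} 4} {p : 𝓢.carrier} {k : ℕ} (Dat : Spacetime.LocalSubconvergence 𝓢ₙ pₙ 𝓢 p k) {M a R : ℝ} {x₀ : Kerr.exterior M a} {Ψ : Kerr.exterior M a → 𝓢.carrier} {O : Set E4} {Ψ' : E4 → 𝓢.carrier} {ε : ℝ≥0∞}, IsOpen O → closure (Subtype.val '' kerrWindow M a x₀ R) ⊆ O → ContMDiffOn 𝓘(ℝ, E4) (𝓡 4) ∞ Ψ' O → (∀ x ∈ kerrWindow M a x₀ R, Ψ x = Ψ' x.1) → supCkENorm (Subtype.val '' kerrWindow M a x₀ R) k (𝓢.deviationExtend (Kerr.background M a) Ψ) < ε → ∀ᶠ n in atTop, supCkENorm (Subtype.val '' kerrWindow M a x₀ R) k ((𝓢ₙ (Dat.sub n)).deviationExtend (Kerr.background M a)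 (Dat.embed n ∘ Ψ)) < ε := by
  intro 𝓢ₙ pₙ 𝓢 p k Dat M a R x₀ Ψ O Ψ' ε hO hKO hΨ' hΨ hε
  set S : Set E4 := Subtype.val '' kerrWindow M a x₀ R with hS
  set K : Set E4 := closure S with hK
  -- the closed window is compact
  have hSball : S ⊆ Metric.ball (x₀ : E4) R := by
    rintro _ ⟨x, hx, rfl⟩
    exact hx
  have hKc : IsCompact K :=
    (isCompact_closedBall (x₀ : E4) R).of_isClosed_subset isClosed_closure
      (closure_minimal (hSball.trans Metric.ball_subset_closedBall) Metric.isClosed_closedBall)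
  have hSO : S ⊆ O := subset_closure.trans hKO
  -- the enlarged background and the representative
  set B' : ModelBackground := ⟨⟨O, hO⟩, Kerr.bilin M a, fun x ↦ x 0, Kerr.radius a⟩ with hB'
  set Ψ'' : B'.domain → 𝓢.carrier := fun z ↦ Ψ' z.1 with hΨ''
  have hΨ''s : ContMDiffOn 𝓘(ℝ, E4) (𝓡 4) ∞ Ψ'' (Subtype.val ⁻¹' O) :=
    hΨ'.comp contMDiff_subtype_val.contMDiffOn fun z hz ↦ hz
  -- the transport theorem on the compact closed window
  have hlim := Dat.tendsto_supCkENorm_deviationExtend_comp_sub B' (W := O) hO (fun z hz ↦ hz) hΨ''s hKc hKO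
  -- differentiability of `Ψ'` on `O` and, eventually, of `embed n ∘ Ψ'` near `K`
  have hΨ'd : ∀ z ∈ O, MDifferentiableAt 𝓘(ℝ, E4) (𝓡 4) (id ∘ Ψ') z := fun z hz ↦
    ((hΨ' z hz).contMDiffAt (hO.mem_nhds hz)).mdifferentiableAt (by simp)
  have hC : IsCompact (Ψ' '' K) := hKc.image_of_continuousOn (hΨ'.continuousOn.mono hKO)
  have hEd : ∀ᶠ n in atTop, ∀ z ∈ O ∩ Ψ' ⁻¹' (Dat.U n : Set 𝓢.carrier),
      MDifferentiableAt 𝓘(ℝ, E4) (𝓡 4) (Dat.embed n ∘ Ψ') z := by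
    refine Eventually.of_forall fun n z hz ↦ ?_
    have h1 : MDifferentiableAt (𝓡 4) (𝓡 4) (Dat.embed n) (Ψ' z) :=
      ((Dat.contMDiffOn_embed n _ hz.2).contMDiffAt ((Dat.U n).isOpen.mem_nhds hz.2)).mdifferentiableAt
        (by simp)
    exact h1.comp z (hΨ'd z hz.1)
  have hKU : ∀ᶠ n in atTop, Ψ' '' K ⊆ Dat.U n := Dat.eventually_subset_U hC
  -- the germ identifications on the window
  have hgerm : ∀ᶠ n in atTop, ∀ y ∈ S,
      ((𝓢ₙ (Dat.sub n)).deviationExtend (Kerr.background M a) (Dat.embed n ∘ Ψ) -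
          𝓢.deviationExtend (Kerr.background M a) Ψ) =ᶠ[𝓝 y]
        ((𝓢ₙ (Dat.sub n)).deviationExtend B' (Dat.embed n ∘ Ψ'') - 𝓢.deviationExtend B' Ψ'') := by
    filter_upwards [hEd, hKU] with n hn hKn y hy
    have hyO : y ∈ O := hSO hy
    have hyU : y ∈ O ∩ Ψ' ⁻¹' (Dat.U n : Set 𝓢.carrier) := ⟨hyO, hKn ⟨y, subset_closure hy, rfl⟩⟩
    have hVo : IsOpen (O ∩ Ψ' ⁻¹' (Dat.U n : Set 𝓢.carrier)) :=
      hΨ'.continuousOn.isOpen_inter_preimage hO (Dat.U n).isOpen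
    have e1 := deviationExtend_comp_eventuallyEq_of_eqOn (𝓣 := 𝓢ₙ (Dat.sub n)) (Dat.embed n) hΨ hVo hn hy hyU
    have e2 := deviationExtend_comp_eventuallyEq_of_eqOn (𝓣 := 𝓢) (M := M) (a := a) id hΨ hO hΨ'd hy hyO
    have e3 := deviationExtend_repr_eventuallyEq (𝓣 := 𝓢ₙ (Dat.sub n)) B' (Dat.embed n) hVo hn hyO hyU
    have e4 := deviationExtend_repr_eventuallyEq (𝓣 := 𝓢) B' id hO hΨ'd hyO hyO
    exact (e1.sub e2).trans (e3.sub e4).symm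
  -- the difference on the window tends to `0`
  have hdiff : Tendsto (fun n ↦ supCkENorm S k
      ((𝓢ₙ (Dat.sub n)).deviationExtend (Kerr.background M a) (Dat.embed n ∘ Ψ) -
        𝓢.deviationExtend (Kerr.background M a) Ψ)) atTop (𝓝 0) := by
    refine tendsto_of_tendsto_of_tendsto_of_le_of_le' tendsto_const_nhds hlim
      (Eventually.of_forall fun _ ↦ zero_le) ?_
    filter_upwards [hgerm] with n hn
    rw [supCkENorm_congr hn]
    exact supCkENorm_mono subset_closure k _
  -- smoothness at window points: the deviation of `Ψ` and the difference
  have hfC : ∀ y ∈ S, ContDiffAt ℝ k (𝓢.deviationExtend (Kerr.background M a) Ψ) y := by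
    intro y hy
    have hyO : y ∈ O := hSO hy
    have e2 := deviationExtend_comp_eventuallyEq_of_eqOn (𝓣 := 𝓢) (M := M) (a := a) id hΨ hO hΨ'd hy hyO
    refine ContDiffAt.congr_of_eventuallyEq ?_ e2
    have hm : ContDiffAt ℝ k (𝓢.metricInCoords (id ∘ Ψ')) y :=
      ((𝓢.contDiffOn_metricInCoords hO hΨ').contDiffAt (hO.mem_nhds hyO)).of_le
        (by exact_mod_cast le_top)
    obtain ⟨x, hx, rfl⟩ := hy
    exact hm.sub ((Kerr.contDiffAt_bilin M a (Kerr.radius_pos_of_mem_region x.2)).of_le le_top)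
  have hgC : ∀ᶠ n in atTop, ∀ y ∈ S, ContDiffAt ℝ k
      ((𝓢ₙ (Dat.sub n)).deviationExtend (Kerr.background M a) (Dat.embed n ∘ Ψ) -
        𝓢.deviationExtend (Kerr.background M a) Ψ) y := by
    filter_upwards [hEd, hKU] with n hn hKn y hy
    have hyO : y ∈ O := hSO hy
    have hyU : y ∈ O ∩ Ψ' ⁻¹' (Dat.U n : Set 𝓢.carrier) := ⟨hyO, hKn ⟨y, subset_closure hy, rfl⟩⟩
    have hVo : IsOpen (O ∩ Ψ' ⁻¹' (Dat.U n : Set 𝓢.carrier)) :=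
      hΨ'.continuousOn.isOpen_inter_preimage hO (Dat.U n).isOpen
    have e1 := deviationExtend_comp_eventuallyEq_of_eqOn (𝓣 := 𝓢ₙ (Dat.sub n)) (Dat.embed n) hΨ hVo hn hy hyU
    have e2 := deviationExtend_comp_eventuallyEq_of_eqOn (𝓣 := 𝓢) (M := M) (a := a) id hΨ hO hΨ'd hy hyO
    refine ContDiffAt.congr_of_eventuallyEq ?_ (e1.sub e2)
    have hE : ContMDiffOn 𝓘(ℝ, E4) (𝓡 4) ∞ (Dat.embed n ∘ Ψ') (O ∩ Ψ' ⁻¹' (Dat.U n : Set 𝓢.carrier)) :=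
      (Dat.contMDiffOn_embed n).comp (hΨ'.mono inter_subset_left) fun z hz ↦ hz.2
    have hm1 : ContDiffAt ℝ k ((𝓢ₙ (Dat.sub n)).metricInCoords (Dat.embed n ∘ Ψ')) y :=
      (((𝓢ₙ (Dat.sub n)).contDiffOn_metricInCoords hVo hE).contDiffAt (hVo.mem_nhds hyU)).of_le
        (by exact_mod_cast le_top)
    have hm2 : ContDiffAt ℝ k (𝓢.metricInCoords (id ∘ Ψ')) y :=
      ((𝓢.contDiffOn_metricInCoords hO hΨ').contDiffAt (hO.mem_nhds hyO)).of_le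
        (by exact_mod_cast le_top)
    obtain ⟨x, hx, rfl⟩ := hy
    have hb : ContDiffAt ℝ k (Kerr.bilin M a) x.1 :=
      (Kerr.contDiffAt_bilin M a (Kerr.radius_pos_of_mem_region x.2)).of_le le_top
    exact (hm1.sub hb).sub (hm2.sub hb)
  -- subadditivity and the limit
  have hsum : ∀ᶠ n in atTop, supCkENorm S k ((𝓢ₙ (Dat.sub n)).deviationExtend (Kerr.background M a)
      (Dat.embed n ∘ Ψ)) ≤ supCkENorm S k (𝓢.deviationExtend (Kerr.background M a) Ψ) +
        supCkENorm S k ((𝓢ₙ (Dat.sub n)).deviationExtend (Kerr.background M a) (Dat.embed n ∘ Ψ) -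
          𝓢.deviationExtend (Kerr.background M a) Ψ) := by
    filter_upwards [hgC] with n hn
    have heq : (𝓢ₙ (Dat.sub n)).deviationExtend (Kerr.background M a) (Dat.embed n ∘ Ψ) =
        𝓢.deviationExtend (Kerr.background M a) Ψ +
          ((𝓢ₙ (Dat.sub n)).deviationExtend (Kerr.background M a) (Dat.embed n ∘ Ψ) -
            𝓢.deviationExtend (Kerr.background M a) Ψ) := (add_sub_cancel _ _).symm
    rw [heq]
    exact (supCkENorm_add_le hfC hn).trans (le_of_eq (by rw [← heq]))
  have hfin : Tendsto (fun n ↦ supCkENorm S k (𝓢.deviationExtend (Kerr.background M a) Ψ) +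
      supCkENorm S k ((𝓢ₙ (Dat.sub n)).deviationExtend (Kerr.background M a) (Dat.embed n ∘ Ψ) -
        𝓢.deviationExtend (Kerr.background M a) Ψ)) atTop
      (𝓝 (supCkENorm S k (𝓢.deviationExtend (Kerr.background M a) Ψ))) := by
    have h := hdiff.const_add (supCkENorm S k (𝓢.deviationExtend (Kerr.background M a) Ψ))
    rwa [add_zero] at h
  filter_upwards [hsum, (tendsto_order.1 hfin).2 ε hε] with n hn hlt
  exact hn.trans_lt hlt

end Summit.FinalStateConjecture.FinalStateConjecture.Theorems

end
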